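import Literature.MathematicalPhysics.QuantumFieldTheory.Balaban1983to89.B6Ineq2148TwoScaleV1
import Literature.MathematicalPhysics.QuantumFieldTheory.Balaban1983to89.B6
import Literature.MathematicalPhysics.QuantumFieldTheory.Balaban1983to89.B3TorusRadialSums

/-!
# `Balaban1983to89.B6TwoScaleGeometryV1` — T. Bałaban, *Propagators and renormalization transformations for lattice gauge theories. II*,
# Commun. Math. Phys. **96** (1984) 223–250 [Balaban1984PropagatorsII], (2.1)–(2.4) p. 224, (2.45)–(2.48) pp. 229–231, (2.97) p. 240: THE GENUINE
# TWO-SCALE FAMILY OF THE DATA `tsV1` READ AS A `…B6.Geometry` — the common, weight-free frame (volume `(m, K)`, level `j + 1 ≤ m + K`, region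
# `Λ′ ⊂ T^{(j+1)}`) on which the verbatim census typings `B6.Prop27Printed` (file `…B6Prop27PrintedTwoScaleV1`) and `B6.Cor28Printed`
# (file `…B6Cor28PrintedTwoScaleV1`) are inhabited

statement-level skeleton of published theorems with citation tags; proofs where landed; nothing here is a claim about the Yang–Mills mass gap

PRINT (pp. 224, 229–231, 248; verbatim where quoted).  p. 224: *"𝔅 = ⋃_{j} Λ_j"* with the scales `L^jη` ((2.1)–(2.4)); p. 229–231: the multiscale distance
`d(y, y′)` (2.46) (paths whose segments inside `Λ_j` are measured in units of `L^jη`) and the localisation vocabulary (cubes `Δ(y)`, `Δ̃(y)`, cut-offs `ζ`,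
`|·|`, `‖·‖_α`); p. 248: *"We consider these operators on the L²-space defined by (2.69) with sites replaced by bonds"*; p. 240 (2.97): the two-scale case
`𝔅 = Λ^c ∪ Λ′` (levels `j` and `j + 1` only).

CITATION HEADER (lean-in-tree rule) — WHAT IS REPRODUCED.  Phase-2 file of the `lit-balaban` typed skeleton (HOME `run/shared/lean/pub/lit-balaban/`), seat
**p22 gen 17** (B6 fold owner r03, referee ref-4).  No SKELETON row of its own: the shared GEOMETRY of the two-scale member instances of rows **B6.Prop2.7**
and **B6.Cor2.8** (as p01's `oneScaleBondGeo` serves `…B6Prop27OneScaleTorus`/`…B6Cor28OneScaleTorus`).  IMPORTS BY NAME: `…B6` (`Geometry`), the V1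
two-scale vocabulary (`CIdx`, `Site.blockSite`, `iterBlockOf`, `Mk`, `rep`, `torusSupNorm`, `supDist`), `…B3TorusRadialSums.supDist_eq_zero_iff`.

THE READING (stated once; every field honest).  **`Frame`** = `(m, K, j, hj : j + 1 ≤ m + K, Λ′ ⊂ T^{(j+1)})`; `Site` := the index set `𝔅 = Λ^c ⊔ Λ′`
(`CIdx j Λ′`, *"sites replaced by bonds"*); `scale` := `j` on `Λ^c`, `j + 1` on `Λ′`; `η := L^{−j}` in the units of the unit torus `T^{(j)}`, so that
`L^{scale}η ∈ {1, L}` (`len_eq`); `dist y c` := the sup-distance of `T^{(j)}` between the SITES of the indices (`site(o) = o₋` for a `Λ^c`-bond `o`, the block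
anchor `x̂(c₋)` for a `Λ′`-bond `c`, as in gen 12–17) — it DOMINATES the two-level (2.46) (`d ≤ (d+1)·dist`: a path inside `Λ_j` costs the `ℓ¹` distance,
paths through `Λ′` are cheaper), so a decay `e^{−δ·dist}` implies the printed `e^{−(δ/(d+1))·d}`; `k := j + 1`; `L := L`; `R := L`; `M := 1` and (2.1)–(2.2)
void (`Hyp21_22 := True`), as in p01's one-scale instance; `Loc := L²(𝔅)` with `suppIn B c` = "supported over the site of `c`", `supNorm B = max|B|`,
`l2Norm B = ‖B‖`, `holder _ B` = the oscillation `max|B(c) − B(c′)|` (the index set is discrete at the unit scale); `Cut` := functions `ζ` on the fine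
sites `T^{(0)}`, `cutIn ζ y` = "supported over the unit sites within `L` of `site(y)`" (⊇ the cubes `Δ(y)`, `Δ̃(y)` of both levels at `M = 1`),
`cutSup ζ = max|ζ|` (`supF`), `cutH α ζ = ‖ζ‖_α + max|ζ|` with `‖ζ‖_α` the (1.109) quotient over pairs of fine sites at sup-distance `≤ n = L^j`
(`holderF`; `t = |x − x′|_∞/n ≤ 1`).

THIS FILE: `Frame`, `Frame.P`/`M`/`site`/`ρ`/`supF`/`holderF`, **`twoScaleGeo`**, `len_eq`, `len_rpow_neg_ge` (`(L^{r₀})⁻¹ ≤ (L^{scale}η)^{−r}` for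
`0 ≤ r ≤ r₀`), `abs_le_supF`, `supF_nonneg`, `holderF_nonneg`, `abs_sub_le_holderF`.  DEFINITIONS (data) + elementary THEOREMS; no `def … : Prop` fact;
standard axioms.  NOT summit progress.  Unit `lit-balaban-p22` (gen 17), 2026-08-22.
-/

noncomputable section

open Finset

namespace Literature.MathematicalPhysics.QuantumFieldTheory.Balaban1983to89.B6TwoScaleGeometryV1

open LatticeFieldCalculus B6SectAOperatorsV1 B6SectCTwoScaleV1 B6SectCTwoScaleV1Lattice B5Eq118OneStroke
open B4TorusKernel.MultiPeriod (torusSupNorm)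
open B5Eq117TorusCarriers (Mk)
open B6LowerBound2153Torus (rep)
open B3TorusRadialSums (supDist_eq_zero_iff)

variable (d L : ℕ) (hd : 1 ≤ d + 1) (hL : Odd L ∧ 1 < L)

/-! ## §1  The frame of a member: volume, level, region -/

/-- the weight-free index of a member of the two-scale family: volume `(m, K)`, level `j` (`j + 1 ≤ m + K`), region `Λ′ ⊂ T^{(j+1)}`.
[cite: Balaban1984PropagatorsII, (2.97) p.240] -/
structure Frame where
  /-- the torus exponent -/
  m : ℕ
  /-- the number of renormalization steps -/
  K : ℕ
  /-- the level -/
  j : ℕ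
  hj : j + 1 ≤ m + K
  /-- the coarse region `Λ′ ⊂ T^{(j+1)}` -/
  Λ' : Finset (Site (⟨d + 1, L, (m : ℕ), K, hd, hL⟩ : Params) (j + 1))

variable {d L hd hL}

namespace Frame

variable (f : Frame d L hd hL)

/-- the parameter set of the member (plumbing). [folklore] -/
abbrev P : Params := ⟨d + 1, L, f.m, f.K, hd, hL⟩

/-- the period vector of its unit torus `T^{(j)}` (plumbing). [folklore] -/
abbrev M : Fin (d + 1) → ℕ := Mk f.P f.j

/-- the site of an index (`o₋` for a `Λ^c`-bond `o`, the block anchor for a `Λ′`-bond). [cite: Balaban1984PropagatorsII, (2.146) p.248] -/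
def site : CIdx f.j f.Λ' → Site f.P f.j :=
  Sum.elim (fun o : OutBond f.j f.Λ' => o.1.src) (fun b₁ : InBond f.j f.Λ' => Site.blockSite b₁.1.src (fun _ => ⟨0, Params.L_pos _⟩))

/-- the torus sup-distance of `T^{(j)}` between unit sites. [cite: Balaban1984PropagatorsI, (1.29) p.23] -/
abbrev ρ (t t' : Site f.P f.j) : ℝ := torusSupNorm f.M (rep f.M t - rep f.M t')

/-- `max|ζ|` of a cut-off on the fine sites. [cite: Balaban1984PropagatorsI, (1.108) p.35] -/
def supF (ζ : Site f.P 0 → ℝ) : ℝ := ⨆ x : Site f.P 0, |ζ x|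

/-- the (1.109) Hölder quotient `‖ζ‖_α = max_{0 < |x − x′|_∞ ≤ n} |ζ(x) − ζ(x′)|/(|x − x′|_∞/n)^α` (pairs at distance `≤ 1` in unit-lattice terms).
[cite: Balaban1984PropagatorsI, (1.109) p.35] -/
def holderF (α : ℝ) (ζ : Site f.P 0 → ℝ) : ℝ :=
  ⨆ q : Site f.P 0 × Site f.P 0,
    if supDist q.1 q.2 ≤ L ^ f.j then |ζ q.1 - ζ q.2| / (((supDist q.1 q.2 : ℕ) : ℝ) / (L : ℝ) ^ f.j) ^ α else 0

/-- the paper's scaling factor `c = η⁻¹ = L^j` is non-zero. [cite: Balaban1984PropagatorsII, (2.95) p.240] -/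
theorem pow_ne_zero' : ((L : ℝ) ^ f.j) ≠ 0 := pow_ne_zero _ (Nat.cast_ne_zero.mpr (by have := hL.2; omega))

/-- `|ζ(x)| ≤ max|ζ|`. [cite: Balaban1984PropagatorsI, (1.108) p.35] -/
theorem abs_le_supF (ζ : Site f.P 0 → ℝ) (x : Site f.P 0) : |ζ x| ≤ f.supF ζ :=
  le_ciSup (f := fun x : Site f.P 0 => |ζ x|) (Set.finite_range _).bddAbove x

/-- `0 ≤ max|ζ|`. [cite: Balaban1984PropagatorsI, (1.108) p.35] -/
theorem supF_nonneg (ζ : Site f.P 0 → ℝ) : 0 ≤ f.supF ζ :=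
  (abs_nonneg _).trans (f.abs_le_supF ζ (fun _ => 0))

/-- `0 ≤ ‖ζ‖_α` (the diagonal pair contributes `0`). [cite: Balaban1984PropagatorsI, (1.109) p.35] -/
theorem holderF_nonneg (α : ℝ) (ζ : Site f.P 0 → ℝ) : 0 ≤ f.holderF α ζ := by
  have h := le_ciSup (f := fun q : Site f.P 0 × Site f.P 0 =>
    if supDist q.1 q.2 ≤ L ^ f.j then |ζ q.1 - ζ q.2| / (((supDist q.1 q.2 : ℕ) : ℝ) / (L : ℝ) ^ f.j) ^ α else 0)
    (Set.finite_range _).bddAbove ((fun _ => 0 : Site f.P 0), (fun _ => 0 : Site f.P 0))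
  refine le_trans ?_ h
  dsimp only
  split_ifs
  · rw [sub_self, abs_zero, zero_div]
  · exact le_rfl

/-- `|ζ(x) − ζ(x′)| ≤ ‖ζ‖_α·(|x − x′|_∞/n)^α` for `|x − x′|_∞ ≤ n`. [cite: Balaban1984PropagatorsI, (1.109) p.35] -/
theorem abs_sub_le_holderF (α : ℝ) (ζ : Site f.P 0 → ℝ) {x x' : Site f.P 0} (hle : supDist x x' ≤ L ^ f.j) :
    |ζ x - ζ x'| ≤ f.holderF α ζ * (((supDist x x' : ℕ) : ℝ) / (L : ℝ) ^ f.j) ^ α := by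
  by_cases hxx : x = x'
  · subst hxx
    rw [sub_self, abs_zero]
    exact mul_nonneg (f.holderF_nonneg α ζ) (Real.rpow_nonneg (by positivity) _)
  have hpos : 0 < (((supDist x x' : ℕ) : ℝ) / (L : ℝ) ^ f.j) ^ α := by
    have hL0 : (0 : ℝ) < L := by exact_mod_cast (lt_trans Nat.zero_lt_one hL.2)
    have hne : supDist x x' ≠ 0 := fun h0 => hxx ((supDist_eq_zero_iff x x').mp h0)
    have : (0 : ℝ) < ((supDist x x' : ℕ) : ℝ) := by exact_mod_cast Nat.pos_of_ne_zero hne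
    exact Real.rpow_pos_of_pos (by positivity) _
  have h := le_ciSup (f := fun q : Site f.P 0 × Site f.P 0 =>
    if supDist q.1 q.2 ≤ L ^ f.j then |ζ q.1 - ζ q.2| / (((supDist q.1 q.2 : ℕ) : ℝ) / (L : ℝ) ^ f.j) ^ α else 0)
    (Set.finite_range _).bddAbove (x, x')
  dsimp only at h
  rw [if_pos hle] at h
  exact (div_le_iff₀ hpos).mp h

end Frame

/-! ## §2  The two-scale geometry -/

/-- **the two-scale geometry of a frame** (see the module docstring for every reading).
[cite: Balaban1984PropagatorsII, (2.1)–(2.4) p.224, (2.45)–(2.48) pp.229–231, p.248] -/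
@[reducible] def twoScaleGeo (f : Frame d L hd hL) : B6.Geometry where
  Site := CIdx f.j f.Λ'
  fin := inferInstance
  scale := Sum.elim (fun _ => f.j) (fun _ => f.j + 1)
  dist := fun y c => f.ρ (f.site y) (f.site c)
  k := f.j + 1
  eta := ((L : ℝ) ^ f.j)⁻¹
  L := L
  R := L
  M := 1
  Hyp21_22 := True
  Loc := CSpace f.j f.Λ'
  suppIn := fun B c => ∀ k, B k ≠ 0 → f.site k = f.site c
  supNorm := fun B => ⨆ k, |B k|
  l2Norm := fun B => ‖B‖
  holder := fun _ B => ⨆ q : CIdx f.j f.Λ' × CIdx f.j f.Λ', |B q.1 - B q.2|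
  Cut := Site f.P 0 → ℝ
  cutIn := fun ζ y => ∀ x, ζ x ≠ 0 → f.ρ (iterBlockOf f.j x) (f.site y) ≤ L
  cutH := fun α ζ => f.holderF α ζ + f.supF ζ
  cutSup := fun ζ => f.supF ζ

/-- `L^{scale}η = 1` on `Λ^c`, `= L` on `Λ′`. [cite: Balaban1984PropagatorsII, (2.1) p.224] -/
theorem len_eq (f : Frame d L hd hL) (y : CIdx f.j f.Λ') :
    (twoScaleGeo f).len y = Sum.elim (fun _ => (1 : ℝ)) (fun _ => (L : ℝ)) y := by
  have hL0 : (L : ℝ) ≠ 0 := Nat.cast_ne_zero.mpr (by have := hL.2; omega)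
  rcases y with o | e
  · show (L : ℝ) ^ f.j * ((L : ℝ) ^ f.j)⁻¹ = 1
    exact mul_inv_cancel₀ (pow_ne_zero _ hL0)
  · show (L : ℝ) ^ (f.j + 1) * ((L : ℝ) ^ f.j)⁻¹ = L
    rw [pow_succ, mul_assoc, mul_comm (L : ℝ), ← mul_assoc, mul_inv_cancel₀ (pow_ne_zero _ hL0), one_mul]

/-- `(L^{r₀})⁻¹ ≤ (L^{scale}η)^{−r}` for `0 ≤ r ≤ r₀`: at two levels the length factors of (2.87)/(2.149)/(2.151) are constants depending on `L`.
[cite: Balaban1984PropagatorsII, (2.149), (2.151) p.249] -/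
theorem len_rpow_neg_ge (f : Frame d L hd hL) (y : CIdx f.j f.Λ') {r r₀ : ℝ} (hr : 0 ≤ r) (hrr : r ≤ r₀) :
    ((L : ℝ) ^ r₀)⁻¹ ≤ (twoScaleGeo f).len y ^ (-r) := by
  have hL1 : (1 : ℝ) ≤ L := by exact_mod_cast hL.2.le
  have h1 : 1 ≤ (twoScaleGeo f).len y := by rw [len_eq]; rcases y with _ | _ <;> simp [hL1]
  have h2 : (twoScaleGeo f).len y ≤ L := by rw [len_eq]; rcases y with _ | _ <;> simp [hL1]
  have h0 : 0 ≤ (twoScaleGeo f).len y := zero_le_one.trans h1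
  rw [Real.rpow_neg h0]
  have h3 : (twoScaleGeo f).len y ^ r ≤ (L : ℝ) ^ r₀ :=
    (Real.rpow_le_rpow h0 h2 hr).trans (Real.rpow_le_rpow_of_exponent_le hL1 hrr)
  exact inv_anti₀ (Real.rpow_pos_of_pos (zero_lt_one.trans_le h1) _) h3

/-- `1 ≤ L^{r₀}·(L^{scale}η)^{−r}` for `0 ≤ r ≤ r₀` (the form used to absorb the length factors into `O(1)`).
[cite: Balaban1984PropagatorsII, (2.149), (2.151) p.249] -/
theorem one_le_rpow_mul_len (f : Frame d L hd hL) (y : CIdx f.j f.Λ') {r r₀ : ℝ} (hr : 0 ≤ r) (hrr : r ≤ r₀) :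
    1 ≤ (L : ℝ) ^ r₀ * (twoScaleGeo f).len y ^ (-r) := by
  have hL0 : (0 : ℝ) < L := by exact_mod_cast (lt_trans Nat.zero_lt_one hL.2)
  have h := mul_le_mul_of_nonneg_left (len_rpow_neg_ge f y hr hrr) (Real.rpow_nonneg hL0.le r₀)
  rwa [mul_inv_cancel₀ (Real.rpow_pos_of_pos hL0 _).ne'] at h

end Literature.MathematicalPhysics.QuantumFieldTheory.Balaban1983to89.B6TwoScaleGeometryV1

end
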